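import Literature.NumberTheory.ComplexMultiplication.WeilTorusToSerreGroupTransition
import Literature.NumberTheory.ComplexMultiplication.SerreGroupLimitLevelPoints
import HarnessLib

/-!
# Milne 1999 §5 Remark 5.2 (a) IN THE LIMIT: the homomorphism `α = X^*(α) : X^*(S) → X^*(P) = W(p^∞)` of the full Serre group,
# for «a fixed prime `w₀` of `ℚ^{al}` lying over `p`» (§6), restricting to `α^K` on every finite Galois CM level `K ⊂ ℚ^{cm}`,
# `Γ`-equivariant, weight-preserving and SURJECTIVE — «on passing to the limit over all `K`, we obtain an injective homomorphism α : P → S»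
# (J. S. Milne, *Lefschetz motives and the Tate conjecture*, Compositio Math. 117 (1999), §5 pp. 62–63, §6 p. 65)

Family `hodge`, lane `lit-hodgefound` (Layer A3; seat `lit-hodgefound-p27`, generation 20, row g20-#3 FILE 2); topic
`Literature/NumberTheory/ComplexMultiplication`, namespace `Literature.NumberTheory.ComplexMultiplication.CMNumbers`.  Definitions WITH BODIES
(`alphaAt`, `cmLevel`, `alphaLimFun`, `alphaLimAddHom`, `alphaLim`, `alphaLimPoints`, and the instance `isCMField_cmLevel`) validated in-file by the
theorems below; no named fact (D-0026, net debt 0).  Sequel of g20-#1 `WeilTorusLevelsExhaustLimit` (`W(p^∞) = ⋃_K W^K(p^∞)`), g20-#2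
`WeilTorusToSerreGroupTransition` (`alphaCharOfPrime_inflateI`: the `α^K` are compatible with the transition maps), FILE 1 `SerreGroupLimitLevelCharacters`
(`resLevel`, `levelChar`, `extendLevel`: g13's level `lambdaLevel K ⊂ infinityTypesCM` `=` skel-3's `infinityTypes Γ Hom(K, ℚ^{cm}) ι`), FILE 3
`SerreGroupLimitLevelPoints` (`serreLevelPointsEquiv R K : serreLevelPoints R K ≃* serrePoints ℚ ℚ^{cm} K ι R`, the same on points), g16-#2/#3 (`alphaCharOfPrime`,
LEMMA 5.1 `mem_weilLimitIn_iff_exists_alphaCharOfPrime_eq`) and of g13-#2/#4/g14 (`infinityTypesCM = X^*(S)`, the levels `lambdaLevel K = X^*(S^K)`,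
`exists_isCMField_mem_lambdaLevel`, `serreLimitPoints R = S(R)`).

THE PRINT.  [Milne1999] §5 p. 62 L31 – p. 63 L9: «Fix a CM-subfield `K` of `ℚ^{al}` of finite degree and Galois over `ℚ` and a prime `w₀` of `K`
lying over `p` … we have a homomorphism `g ↦ [g(ϖ)] : X^*(S^K) → W^K(p^∞)`. … It commutes with the action of `Γ`, and so defines a homomorphism
`α^K : P^K → S^K`.»  REMARK 5.2 (a) (p. 63): «The lemma shows that the homomorphism `α^K : P^K → S^K` is injective. On passing to the limit over
all `K`, we obtain an injective homomorphism `α : P → S`.»  §6 p. 65 («w₀ is a fixed prime of ℚ^{al} lying over p»): «In this section, `ℚ^{al}` is the algebraic closure of `ℚ` in `ℂ`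
and `w₀` is a fixed prime of `ℚ^{al}` lying over `p`.»  And [MilneCM2006] Ch. I §4 p. 42: «The character group of `S` is `I = lim→ I(K)`»
(the tree's `infinityTypesCM`, `lambdaLevel`, `iSup_lambdaLevel`).

WHAT «PASSING TO THE LIMIT» NEEDS, AND WHAT IS PROVED.  The `α^K` depend on the prime `w₀` of `K`; a single map on `X^*(S) = ⋃_K X^*(S^K)` needs
COHERENT base primes, which is exactly what Milne's standing choice of §6 provides: a prime `𝔴` of `𝓞_{ℚ^{cm}}` over `p` (they exist,
`exists_ideal_liesOver_span`) and `w₀^K = 𝔴 ∩ K` at every level.  With g20-#2's transition compatibility the `α^K_{𝔴 ∩ K}` then glue: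
* (FILE 1) `resLevel K : σ ↦ σ|_K`, `levelChar K F = F|_K`, `extendLevel K : X^*(S^K) ↪ X^*(S)`, `levelChar_mono` (going up a level is `X^*`
  of the norm map), `lambdaLevel_eq_map_inflate_resLevel`;
* §3 `alphaAt K F = α^K_{𝔴 ∩ K}(F|_K)` and **`alphaAt_mono` / `alphaAt_eq`: INDEPENDENCE OF THE LEVEL** (g20-#2 `alphaCharOfPrime_inflateI` + a common
  finite Galois CM level above any two, CM because it contains `i`, g13 `isCMField_of_iCM_mem`);
* §4 **`alphaLim p 𝔴 : X^*(S) →ₗ[ℤ] X^*(P) = W(p^∞)`**, THE LIMIT MAP: `alphaLim_extendLevel` (it IS `α^K_{𝔴∩K}` on `X^*(S^K)`, every finite Galois CM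
  `K`), `alphaLim_unique` (the only additive map with this property), `alphaLim_rep` («commutes with the action of `Γ`»), `weilLimExp_alphaLim` (Rem.
  5.2 (c): weights, `s ↦ p` as `alphaLim_const_one`), and **`alphaLim_surjective`** — BY g20-#1 (`W(p^∞) = ⋃_K W^K(p^∞)`) AND LEMMA 5.1 AT EACH
  LEVEL: `X^*(α)` is onto, i.e. «we obtain an INJECTIVE homomorphism `α : P → S`»; levelwise `image_alphaLim_lambdaLevel`: `α(Λ^K) = W^K(p^∞)`;
* §5 ON POINTS: `alphaLimPoints p 𝔴 R : P(R) → S(R) = serreLimitPoints R` for every commutative `ℚ`-algebra `R`, natural values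
  (`alphaLimPoints_apply_extendLevel`: its `K`-component is `α^K(R)`), and `alphaLimPoints_injective`;
* §6 THE SQUARE WITH THE PROJECTIONS: **`serreLevelPointsEquiv_toLevel_alphaLimPoints`** — g13-#4's projection `toLevel : S(R) → S^K(R)` after `α(R)`, read in
  skel-3's carrier through FILE 3's `serreLevelPointsEquiv`, IS g16-#2's `alphaPointsOfPrime p (𝔴 ∩ K) R : P(R) → S^K(R)`.

SCOPE (docstring, not claims): the Tannakian meaning of `S`, `P` (fundamental groups of `CM(ℚ^{al})`, `Mot(𝔽)`), THEOREM 6.1 (`P = L ∩ S` in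
`T`, Layer B, B5-09) and Lemma 6.2's limit diagram with `L`, `T` are NOT here; nothing in this file is a case of the Hodge conjecture.

## Shape of the entries

* Vocabulary: g13-#2 `infinityTypesCM`, `lambdaLevel`, `infinityTypesCMRep`, `weightCM`; skel-3 `infinityTypes`, `inflate`, `characterRep`,
  `weight`, `SerreGroupTorus.inflateI` / `infinityTypesRep` / `constChar`; the tree's `restrictEmb` and the scoped composition action of
  `EmbeddingAction`; FILE 1 `resLevel`, `levelChar`, `extendLevel`; FILE 3 `serreLevelPointsEquiv`; g15/g16 `WeilLimit p`, `weilLimRep`, `weilLimExp`, `pGerm`, `weilTorusPoints`, `alphaCharOfPrime`, `alphaPointsOfPrime`,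
  `weilLimitIn`; g13-#4 `serreLimitPoints`; Mathlib `FiniteGaloisIntermediateField`, `Ideal.under`, `Ideal.LiesOver`.
* Levels are `IntermediateField ℚ cmNumbers` of finite degree (resp. Mathlib's `FiniteGaloisIntermediateField ℚ cmNumbers` when Galois is needed),
  CM-ness is the hypothesis `[IsCMField K]`; the abstract-field theorems of g16/g20 are applied to `↥K`.

## References

* [Milne1999] J. S. Milne, *Lefschetz motives and the Tate conjecture*, Compositio Math. 117 (1999) 45–76, §5 pp. 62–63 (the maps `α^K`,
  Lemma 5.1, Remark 5.2), §6 p. 65 («w₀ is a fixed prime of ℚ^{al} lying over p») («`w₀` is a fixed prime of `ℚ^{al}` lying over `p`»), p. 66 («On passing to the limit over all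
  `K ⊂ ℚ^{cm}`»).
* [MilneCM2006] J. S. Milne, *Complex Multiplication* (course notes, 2006), Ch. I §4 pp. 40–43 (`I(K)`, `f ↦ f^L`, «The character group of `S`
  is `I`», Prop. 4.20: the norm maps `S^{L} → S^{K}`).
* [MilneShih1982Taniyama] J. S. Milne, K.-y. Shih, *Langlands's construction of the Taniyama group*, LNM 900 (1982), Ch. III §1 (1.1)–(1.3)
  (pp. 230–231: `X^*(S^L) ⊂ X^*(L^×)`, transport of structure along `σ ↦ σ|L`).

Provenance: lane `lit-hodgefound`, seat `lit-hodgefound-p27` gen 20 (agent `literature-prover-lit-hodgefound-p27-g20-0`), row g20-#3 FILE 2.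
-/

set_option autoImplicit false

noncomputable section

open scoped NumberField TensorProduct IntermediateField

namespace Literature.NumberTheory.ComplexMultiplication

namespace CMNumbers

open _root_.NumberField
open Literature.NumberTheory.NumberFields (cmNumbers cmNumbersConj cmNumbersConj_mem_center)
open SerreGroupTorus (inflateI coe_inflateI_apply inflateI_apply_apply infinityTypesRep coe_infinityTypesRep_apply constChar coe_constChar)
open Literature.RingTheory.GaloisAlgebras.CharacterModuleTorus (torusPoints)

universe u

/-! ### §3 «`w₀` is a fixed prime of `ℚ^{al}` lying over `p`»: `α^K` at the coherent base primes `𝔴 ∩ K`, and independence of the level -/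

section Alpha

variable (p : ℕ) [hp : Fact p.Prime]

/-- **Primes of `𝓞_{ℚ^{cm}}` over `p` exist** («`w₀` is a fixed prime of `ℚ^{al}` lying over `p`»: the hypothesis of this section is not vacuous;
`𝓞_{ℚ^{cm}}` is integral over `ℤ`). [cite: Milne1999, §6 p. 65 («w₀ is a fixed prime of ℚ^{al} lying over p»)] -/
theorem exists_ideal_liesOver_span : ∃ 𝔴 : Ideal (𝓞 cmNumbers), 𝔴.IsPrime ∧ 𝔴.LiesOver (Ideal.span {(p : ℤ)}) := by
  haveI : (Ideal.span {(p : ℤ)}).IsPrime :=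
    (Ideal.span_singleton_prime (by exact_mod_cast hp.1.ne_zero)).mpr (Nat.prime_iff_prime_int.mp hp.1)
  obtain ⟨Q, -, hQ, hQ'⟩ := Ideal.exists_ideal_over_prime_of_isIntegral (Ideal.span {(p : ℤ)}) (⊥ : Ideal (𝓞 cmNumbers)) (by
    rw [← RingHom.ker_eq_comap_bot, (RingHom.injective_iff_ker_eq_bot _).mp (algebraMap ℤ (𝓞 cmNumbers)).injective_int]
    exact bot_le)
  exact ⟨Q, hQ, ⟨by rw [Ideal.under_def, hQ']⟩⟩

/-- `α^K_𝔭` depends on the prime `𝔭` only through the ideal (instance arguments are irrelevant). [cite: Milne1999, §5 p. 63 L6–L8] -/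
theorem alphaCharOfPrime_congr {K : Type} [Field K] [NumberField K] [IsCMField K] {𝔭 𝔭' : Ideal (𝓞 K)} [𝔭.IsPrime]
    [𝔭.LiesOver (Ideal.span {(p : ℤ)})] [𝔭'.IsPrime] [𝔭'.LiesOver (Ideal.span {(p : ℤ)})] (h : 𝔭 = 𝔭')
    (g : infinityTypes (cmNumbers ≃ₐ[ℚ] cmNumbers) (K →ₐ[ℚ] cmNumbers) cmNumbersConj) :
    alphaCharOfPrime p 𝔭 g = alphaCharOfPrime p 𝔭' g := by
  subst h
  rfl

variable (𝔴 : Ideal (𝓞 cmNumbers)) [h𝔴P : 𝔴.IsPrime] [h𝔴 : 𝔴.LiesOver (Ideal.span {(p : ℤ)})]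

/-- **`α^K` AT THE COHERENT BASE PRIME `w₀^K = 𝔴 ∩ K`, READ ON `Λ^K ⊂ X^*(S)`**: `alphaAt K F = [ (F|_K)(ϖ_{𝔴 ∩ K}) ] ∈ W(p^∞)` (g16-#2's
`alphaCharOfPrime` of the level `K`, a CM field of finite degree inside `ℚ^{cm}`). [cite: Milne1999, §5 p. 63 L6–L9, §6 p. 65 («w₀ is a fixed prime of ℚ^{al} lying over p»)] -/
def alphaAt (K : IntermediateField ℚ cmNumbers) [FiniteDimensional ℚ K] [IsCMField K] (F : (cmNumbers ≃ₐ[ℚ] cmNumbers) → ℤ)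
    (hF : F ∈ lambdaLevel K) : Additive (WeilLimit p) :=
  alphaCharOfPrime p (𝔴.under (𝓞 K)) (levelChar K F hF)

variable {K : IntermediateField ℚ cmNumbers} [FiniteDimensional ℚ K] [IsCMField K]

/-- `alphaAt K (f^{ℚ^{cm}}) = α^K_{𝔴∩K}(f)`. [cite: Milne1999, §5 p. 63 L6–L9] -/
theorem alphaAt_inflate_resLevel (g : infinityTypes (cmNumbers ≃ₐ[ℚ] cmNumbers) (K →ₐ[ℚ] cmNumbers) cmNumbersConj) :
    alphaAt p 𝔴 K (inflate (resLevel K) g.1) (inflate_resLevel_mem_lambdaLevel g.2) =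
      alphaCharOfPrime p (𝔴.under (𝓞 K)) g := by
  unfold alphaAt
  rw [levelChar_inflate_resLevel]

/-- `alphaAt K F` depends only on the function `F` (congruence for rewriting under the membership proof). [cite: Milne1999, §5 p. 63 L6–L8] -/
theorem alphaAt_congr {F F' : (cmNumbers ≃ₐ[ℚ] cmNumbers) → ℤ} (h : F = F') (hF : F ∈ lambdaLevel K) (hF' : F' ∈ lambdaLevel K) :
    alphaAt p 𝔴 K F hF = alphaAt p 𝔴 K F' hF' := by
  subst h
  rfl

/-- `alphaAt K` is additive. [cite: Milne1999, §5 p. 63 L6–L8 («homomorphism»)] -/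
theorem alphaAt_add (F G : (cmNumbers ≃ₐ[ℚ] cmNumbers) → ℤ) (hF : F ∈ lambdaLevel K) (hG : G ∈ lambdaLevel K) :
    alphaAt p 𝔴 K (F + G) (add_mem hF hG) = alphaAt p 𝔴 K F hF + alphaAt p 𝔴 K G hG := by
  unfold alphaAt
  rw [levelChar_add, map_add]

/-- **`alphaAt K` «commutes with the action of `Γ`»** (g16-#2 `alphaCharOfPrime_infinityTypesRep` and `levelChar_characterRep`).
[cite: Milne1999, §5 p. 63 L8–L9] -/
theorem alphaAt_characterRep (σ : cmNumbers ≃ₐ[ℚ] cmNumbers) (F : (cmNumbers ≃ₐ[ℚ] cmNumbers) → ℤ) (hF : F ∈ lambdaLevel K) :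
    alphaAt p 𝔴 K (characterRep (cmNumbers ≃ₐ[ℚ] cmNumbers) (cmNumbers ≃ₐ[ℚ] cmNumbers) σ F) (characterRep_mem_lambdaLevel K σ hF) =
      weilLimRep p σ (alphaAt p 𝔴 K F hF) := by
  unfold alphaAt
  rw [levelChar_characterRep, alphaCharOfPrime_infinityTypesRep]

/-- **Weights (Rem. 5.2 (c))**: `wt [ (F|_K)(ϖ) ] = wt(F)` — `weilLimExp (alphaAt K F) = −weightCM F` (the tree's sign conventions:
`weilLimExp = −`Milne's weight on `W`, `weightCM F = −(F(1) + F(ι))`). [cite: Milne1999, §5 p. 63 L2–L3, Rem. 5.2 (c)] -/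
theorem weilLimExp_alphaAt (F : (cmNumbers ≃ₐ[ℚ] cmNumbers) → ℤ) (hF : F ∈ lambdaLevel K) :
    weilLimExp (Additive.toMul (alphaAt p 𝔴 K F hF)) = -weightCM F := by
  unfold alphaAt
  rw [weilLimExp_alphaCharOfPrime p _ _ (resLevel K 1), weight_levelChar]

/-- **INDEPENDENCE OF THE LEVEL, I** — for finite Galois CM levels `K ⊂ K′ ⊂ ℚ^{cm}` and `F ∈ Λ^K`: `alphaAt K′ F = alphaAt K F`.  This is g20-#2's
transition compatibility `α^{K′}_𝔓 ∘ X^*(Nm) = α^K_{𝔓 ∩ K}` at `𝔓 = 𝔴 ∩ K′` (so `𝔓 ∩ K = 𝔴 ∩ K`), with `F|_{K′} = X^*(Nm)(F|_K)` (`levelChar_mono`).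
[cite: Milne1999, §5 p. 63 Rem. 5.2 (a) («on passing to the limit over all K»), §6 p. 65 («w₀ is a fixed prime of ℚ^{al} lying over p»)] -/
theorem alphaAt_mono {K' : IntermediateField ℚ cmNumbers} [FiniteDimensional ℚ K'] [IsCMField K'] [IsGalois ℚ K] [IsGalois ℚ K']
    (h : K ≤ K') (F : (cmNumbers ≃ₐ[ℚ] cmNumbers) → ℤ) (hF : F ∈ lambdaLevel K) :
    alphaAt p 𝔴 K' F (lambdaLevel_mono h hF) = alphaAt p 𝔴 K F hF := by
  letI : Algebra K K' := (levelInclusion h).toRingHom.toAlgebra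
  -- shortcuts for instance search (the inherited actions of intermediate fields make these searches slow)
  letI : Module K K' := Algebra.toModule
  haveI : IsScalarTower ℚ K K' := IsScalarTower.rat
  haveI : IsScalarTower K K' cmNumbers := IsScalarTower.of_algebraMap_eq fun _ => rfl
  have hj : IsScalarTower.toAlgHom ℚ K K' = levelInclusion h := AlgHom.ext fun _ => rfl
  have hP : (𝔴.under (𝓞 K')).under (𝓞 K) = 𝔴.under (𝓞 K) := Ideal.under_under _
  unfold alphaAt
  rw [levelChar_mono h F hF, ← hj, alphaCharOfPrime_inflateI (K₀ := K) (K := K') (𝔴.under (𝓞 K')) (levelChar K F hF)]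
  exact alphaCharOfPrime_congr p hP _

/-- **INDEPENDENCE OF THE LEVEL, II** — any two finite Galois CM levels carrying `F` give the same `alphaAt`: compare both with the finite Galois
level `K₁K₂ℚ(i)` above them, CM because it contains `i` (g13 `isCMField_of_iCM_mem`). [cite: Milne1999, §5 p. 63 Rem. 5.2 (a), §6 p. 65 («w₀ is a fixed prime of ℚ^{al} lying over p»)] -/
theorem alphaAt_eq (K₁ K₂ : FiniteGaloisIntermediateField ℚ cmNumbers) [IsCMField (K₁ : IntermediateField ℚ cmNumbers)]
    [IsCMField (K₂ : IntermediateField ℚ cmNumbers)] (F : (cmNumbers ≃ₐ[ℚ] cmNumbers) → ℤ)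
    (h₁ : F ∈ lambdaLevel (K₁ : IntermediateField ℚ cmNumbers)) (h₂ : F ∈ lambdaLevel (K₂ : IntermediateField ℚ cmNumbers)) :
    alphaAt p 𝔴 (K₁ : IntermediateField ℚ cmNumbers) F h₁ = alphaAt p 𝔴 (K₂ : IntermediateField ℚ cmNumbers) F h₂ := by
  let L : FiniteGaloisIntermediateField ℚ cmNumbers := K₁ ⊔ K₂ ⊔ levelI
  haveI : IsCMField (L : IntermediateField ℚ cmNumbers) :=
    isCMField_of_iCM_mem L ((FiniteGaloisIntermediateField.le_iff _ _).mp (le_sup_right : levelI ≤ L) iCM_mem_levelI)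
  have h₁L : (K₁ : IntermediateField ℚ cmNumbers) ≤ L :=
    (FiniteGaloisIntermediateField.le_iff _ _).mp ((le_sup_left : K₁ ≤ K₁ ⊔ K₂).trans (le_sup_left : K₁ ⊔ K₂ ≤ L))
  have h₂L : (K₂ : IntermediateField ℚ cmNumbers) ≤ L :=
    (FiniteGaloisIntermediateField.le_iff _ _).mp ((le_sup_right : K₂ ≤ K₁ ⊔ K₂).trans (le_sup_left : K₁ ⊔ K₂ ≤ L))
  rw [← alphaAt_mono p 𝔴 h₁L F h₁, ← alphaAt_mono p 𝔴 h₂L F h₂]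

end Alpha

/-! ### §4 THE LIMIT MAP `α = X^*(α) : X^*(S) → X^*(P) = W(p^∞)` -/

section Limit

variable (p : ℕ) [hp : Fact p.Prime] (𝔴 : Ideal (𝓞 cmNumbers)) [h𝔴P : 𝔴.IsPrime] [h𝔴 : 𝔴.LiesOver (Ideal.span {(p : ℤ)})]

/-- A finite Galois CM level carrying `F ∈ X^*(S)` (g13's `exists_isCMField_mem_lambdaLevel`, chosen). [cite: MilneCM2006, Ch. I §4 p. 42 («where K runs over … the CM-subfields»)] -/
def cmLevel (F : infinityTypesCM) : FiniteGaloisIntermediateField ℚ cmNumbers :=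
  Classical.choose (exists_isCMField_mem_lambdaLevel F.2)

/-- `cmLevel F` is a CM field. [cite: MilneCM2006, Ch. I §4 p. 42] -/
instance isCMField_cmLevel (F : infinityTypesCM) : IsCMField ((cmLevel F : FiniteGaloisIntermediateField ℚ cmNumbers) : IntermediateField ℚ cmNumbers) :=
  (Classical.choose_spec (exists_isCMField_mem_lambdaLevel F.2)).1

/-- `F ∈ Λ^{cmLevel F}`. [cite: MilneCM2006, Ch. I §4 p. 42 («I = lim→ I(K)»)] -/
theorem mem_lambdaLevel_cmLevel (F : infinityTypesCM) :
    (F : (cmNumbers ≃ₐ[ℚ] cmNumbers) → ℤ) ∈ lambdaLevel ((cmLevel F : FiniteGaloisIntermediateField ℚ cmNumbers) : IntermediateField ℚ cmNumbers) :=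
  (Classical.choose_spec (exists_isCMField_mem_lambdaLevel F.2)).2

/-- `α` as a bare function: `F ↦ alphaAt (cmLevel F) F`. [cite: Milne1999, §5 p. 63 Rem. 5.2 (a)] -/
def alphaLimFun (F : infinityTypesCM) : Additive (WeilLimit p) :=
  alphaAt p 𝔴 ((cmLevel F : FiniteGaloisIntermediateField ℚ cmNumbers) : IntermediateField ℚ cmNumbers) F (mem_lambdaLevel_cmLevel F)

/-- `alphaLimFun F` may be computed at ANY finite Galois CM level carrying `F` (`alphaAt_eq`). [cite: Milne1999, §5 p. 63 Rem. 5.2 (a), §6 p. 65 («w₀ is a fixed prime of ℚ^{al} lying over p»)] -/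
theorem alphaLimFun_eq (K : FiniteGaloisIntermediateField ℚ cmNumbers) [IsCMField (K : IntermediateField ℚ cmNumbers)] (F : infinityTypesCM)
    (hF : (F : (cmNumbers ≃ₐ[ℚ] cmNumbers) → ℤ) ∈ lambdaLevel (K : IntermediateField ℚ cmNumbers)) :
    alphaLimFun p 𝔴 F = alphaAt p 𝔴 (K : IntermediateField ℚ cmNumbers) F hF :=
  alphaAt_eq p 𝔴 (cmLevel F) K _ (mem_lambdaLevel_cmLevel F) hF

/-- `alphaLimFun` is additive — because `alphaAt` does not depend on the level: compute all three terms at a common finite Galois CM level.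
[cite: Milne1999, §5 p. 63 Rem. 5.2 (a) («On passing to the limit over all K»)] -/
theorem alphaLimFun_add (F G : infinityTypesCM) : alphaLimFun p 𝔴 (F + G) = alphaLimFun p 𝔴 F + alphaLimFun p 𝔴 G := by
  let L : FiniteGaloisIntermediateField ℚ cmNumbers := cmLevel F ⊔ cmLevel G ⊔ levelI
  haveI : IsCMField (L : IntermediateField ℚ cmNumbers) :=
    isCMField_of_iCM_mem L ((FiniteGaloisIntermediateField.le_iff _ _).mp (le_sup_right : levelI ≤ L) iCM_mem_levelI)
  have hFL : (F : (cmNumbers ≃ₐ[ℚ] cmNumbers) → ℤ) ∈ lambdaLevel (L : IntermediateField ℚ cmNumbers) :=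
    lambdaLevel_mono ((FiniteGaloisIntermediateField.le_iff _ _).mp
      ((le_sup_left : cmLevel F ≤ cmLevel F ⊔ cmLevel G).trans (le_sup_left : cmLevel F ⊔ cmLevel G ≤ L))) (mem_lambdaLevel_cmLevel F)
  have hGL : (G : (cmNumbers ≃ₐ[ℚ] cmNumbers) → ℤ) ∈ lambdaLevel (L : IntermediateField ℚ cmNumbers) :=
    lambdaLevel_mono ((FiniteGaloisIntermediateField.le_iff _ _).mp
      ((le_sup_right : cmLevel G ≤ cmLevel F ⊔ cmLevel G).trans (le_sup_left : cmLevel F ⊔ cmLevel G ≤ L))) (mem_lambdaLevel_cmLevel G)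
  have hFGL : ((F + G : infinityTypesCM) : (cmNumbers ≃ₐ[ℚ] cmNumbers) → ℤ) ∈ lambdaLevel (L : IntermediateField ℚ cmNumbers) :=
    add_mem hFL hGL
  rw [alphaLimFun_eq p 𝔴 L (F + G) hFGL, alphaLimFun_eq p 𝔴 L F hFL, alphaLimFun_eq p 𝔴 L G hGL, ← alphaAt_add]
  exact alphaAt_congr p 𝔴 (Submodule.coe_add F G) _ _

/-- `alphaLimFun 0 = 0`. [cite: Milne1999, §5 p. 63 Rem. 5.2 (a)] -/
theorem alphaLimFun_zero : alphaLimFun p 𝔴 0 = 0 := by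
  have h := alphaLimFun_add p 𝔴 0 0
  rw [add_zero] at h
  exact left_eq_add.mp h

/-- **`α : X^*(S) → W(p^∞)` as an additive map.** [cite: Milne1999, §5 p. 63 Rem. 5.2 (a) («On passing to the limit over all K, we obtain … α : P → S»)] -/
def alphaLimAddHom : infinityTypesCM →+ Additive (WeilLimit p) where
  toFun := alphaLimFun p 𝔴
  map_zero' := alphaLimFun_zero p 𝔴
  map_add' := alphaLimFun_add p 𝔴

/-- **THE HOMOMORPHISM `α = X^*(α) : X^*(S) → X^*(P) = W(p^∞)` OF THE (FULL) SERRE GROUP AT THE FIXED PRIME `𝔴` OF `ℚ^{cm}` OVER `p`**, `ℤ`-linear.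
[cite: Milne1999, §5 p. 63 Rem. 5.2 (a) («On passing to the limit over all K, we obtain an injective homomorphism α : P → S»), §6 p. 65 («w₀ is a fixed prime of ℚ^{al} lying over p»)] -/
def alphaLim : infinityTypesCM →ₗ[ℤ] Additive (WeilLimit p) :=
  (alphaLimAddHom p 𝔴).toIntLinearMap

/-- Unfolding `alphaLim` at the chosen level. [cite: Milne1999, §5 p. 63 Rem. 5.2 (a)] -/
theorem alphaLim_apply (F : infinityTypesCM) :
    alphaLim p 𝔴 F = alphaAt p 𝔴 ((cmLevel F : FiniteGaloisIntermediateField ℚ cmNumbers) : IntermediateField ℚ cmNumbers) F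
      (mem_lambdaLevel_cmLevel F) := rfl

/-- **`α` AT ANY finite Galois CM level `K` carrying `F`: `α(F) = α^K_{𝔴∩K}(F|_K)`.** [cite: Milne1999, §5 p. 63 Rem. 5.2 (a), §6 p. 65 («w₀ is a fixed prime of ℚ^{al} lying over p»)] -/
theorem alphaLim_apply_of_mem (K : FiniteGaloisIntermediateField ℚ cmNumbers) [IsCMField (K : IntermediateField ℚ cmNumbers)]
    (F : infinityTypesCM) (hF : (F : (cmNumbers ≃ₐ[ℚ] cmNumbers) → ℤ) ∈ lambdaLevel (K : IntermediateField ℚ cmNumbers)) :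
    alphaLim p 𝔴 F = alphaCharOfPrime p (𝔴.under (𝓞 (K : IntermediateField ℚ cmNumbers))) (levelChar (K : IntermediateField ℚ cmNumbers) F hF) :=
  alphaLimFun_eq p 𝔴 K F hF

/-- **`α|_{X^*(S^K)} = α^K`**: on the image of `extendLevel K : X^*(S^K) ↪ X^*(S)`, `α` is g16-#2's `alphaCharOfPrime p (𝔴 ∩ K)` — the maps `α^K`
of all finite Galois CM levels `K ⊂ ℚ^{cm}` ARE the restrictions of one map. [cite: Milne1999, §5 p. 63 Rem. 5.2 (a) («on passing to the limit over all K»)] -/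
theorem alphaLim_extendLevel (K : FiniteGaloisIntermediateField ℚ cmNumbers) [IsCMField (K : IntermediateField ℚ cmNumbers)]
    (g : infinityTypes (cmNumbers ≃ₐ[ℚ] cmNumbers) ((K : IntermediateField ℚ cmNumbers) →ₐ[ℚ] cmNumbers) cmNumbersConj) :
    alphaLim p 𝔴 (extendLevel (K : IntermediateField ℚ cmNumbers) g) = alphaCharOfPrime p (𝔴.under (𝓞 (K : IntermediateField ℚ cmNumbers))) g := by
  rw [alphaLim_apply_of_mem p 𝔴 K _ (extendLevel_mem_lambdaLevel _ g), levelChar_extendLevel]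

/-- **UNIQUENESS**: an additive map `X^*(S) → W(p^∞)` that is `α^K_{𝔴∩K}` on every finite Galois CM level IS `α` (the levels exhaust `X^*(S)`,
g13 `exists_isCMField_mem_lambdaLevel`). [cite: Milne1999, §5 p. 63 Rem. 5.2 (a)] [cite: MilneCM2006, Ch. I §4 p. 42 («I = lim→ I(K)»)] -/
theorem alphaLim_unique (β : infinityTypesCM →+ Additive (WeilLimit p))
    (hβ : ∀ (K : FiniteGaloisIntermediateField ℚ cmNumbers) [IsCMField (K : IntermediateField ℚ cmNumbers)]
      (g : infinityTypes (cmNumbers ≃ₐ[ℚ] cmNumbers) ((K : IntermediateField ℚ cmNumbers) →ₐ[ℚ] cmNumbers) cmNumbersConj),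
      β (extendLevel (K : IntermediateField ℚ cmNumbers) g) = alphaCharOfPrime p (𝔴.under (𝓞 (K : IntermediateField ℚ cmNumbers))) g) :
    β = alphaLimAddHom p 𝔴 := by
  refine AddMonoidHom.ext fun F => ?_
  obtain ⟨g, hg⟩ := exists_extendLevel_eq _ F (mem_lambdaLevel_cmLevel F)
  rw [← hg, hβ]
  exact (alphaLim_extendLevel p 𝔴 (cmLevel F) g).symm

/-- **«IT COMMUTES WITH THE ACTION OF `Γ`»**: `α(σF) = σ·α(F)` for g13-#4's `infinityTypesCMRep` and g15-#3's `weilLimRep`.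
[cite: Milne1999, §5 p. 63 L8–L9, Rem. 5.2 (a)] -/
theorem alphaLim_rep (σ : cmNumbers ≃ₐ[ℚ] cmNumbers) (F : infinityTypesCM) :
    alphaLim p 𝔴 (infinityTypesCMRep σ F) = weilLimRep p σ (alphaLim p 𝔴 F) := by
  rw [alphaLim_apply_of_mem p 𝔴 (cmLevel F) F (mem_lambdaLevel_cmLevel F),
    alphaLim_apply_of_mem p 𝔴 (cmLevel F) (infinityTypesCMRep σ F)
      (characterRep_mem_lambdaLevel _ σ (mem_lambdaLevel_cmLevel F))]
  exact alphaAt_characterRep p 𝔴 σ _ (mem_lambdaLevel_cmLevel F)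

/-- **WEIGHTS (Rem. 5.2 (c) in the limit)**: `weilLimExp (α F) = −weightCM F`. [cite: Milne1999, §5 p. 63 Rem. 5.2 (c)] -/
theorem weilLimExp_alphaLim (F : infinityTypesCM) : weilLimExp (Additive.toMul (alphaLim p 𝔴 F)) = -weightCM (F : (cmNumbers ≃ₐ[ℚ] cmNumbers) → ℤ) :=
  weilLimExp_alphaAt p 𝔴 _ (mem_lambdaLevel_cmLevel F)

/-- **Rem. 5.2 (c) in the limit, `s ↦ p`**: the constant character `1 = X^*(t)(1)` of `S` goes to the class `[p] ∈ W(p^∞)`.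
[cite: Milne1999, §5 p. 63 Rem. 5.2 (c)] -/
theorem alphaLim_const_one :
    alphaLim p 𝔴 ⟨fun _ => 1, (const_one_mem_lambdaLevel (K := (⊥ : IntermediateField ℚ cmNumbers))).1⟩ = Additive.ofMul (pGerm : WeilLimit p) := by
  haveI : IsCMField (levelI : IntermediateField ℚ cmNumbers) := isCMField_of_iCM_mem levelI iCM_mem_levelI
  rw [alphaLim_apply_of_mem p 𝔴 levelI _ const_one_mem_lambdaLevel, levelChar_const_one, alphaCharOfPrime_constChar_one]

/-- **`α = X^*(α) : X^*(S) → X^*(P)` IS SURJECTIVE — «we obtain an INJECTIVE homomorphism `α : P → S`».**  Every `x ∈ W(p^∞)` lies in some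
`W^K(p^∞)` for an abstract finite Galois CM `K → ℚ^{cm}` (g20-#1 `exists_level_mem_weilLimitIn'`); its image generates, together with `i`, a finite
Galois CM level `E ⊂ ℚ^{cm}` with `W^K(p^∞) ≤ W^E(p^∞)` (g20-#1 `weilLimitIn_le_of_algHom`), and LEMMA 5.1 at `E` (g16-#3) writes `x = α^E_{𝔴∩E}(g)`.
[cite: Milne1999, §5 p. 63 Lemma 5.1, Rem. 5.2 (a)] -/
theorem alphaLim_surjective : Function.Surjective (alphaLim p 𝔴) := fun x => by
  obtain ⟨K, _, _, _, _, τ₀, hx⟩ := exists_level_mem_weilLimitIn' (p := p) (Additive.toMul x)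
  obtain ⟨θ, hθ⟩ := Field.exists_primitive_element ℚ K
  let E : FiniteGaloisIntermediateField ℚ cmNumbers := FiniteGaloisIntermediateField.adjoin ℚ ({τ₀ θ} : Set cmNumbers) ⊔ levelI
  haveI : IsCMField (E : IntermediateField ℚ cmNumbers) :=
    isCMField_of_iCM_mem E ((FiniteGaloisIntermediateField.le_iff _ _).mp (le_sup_right : levelI ≤ E) iCM_mem_levelI)
  have hθE : τ₀ θ ∈ (E : IntermediateField ℚ cmNumbers) :=
    (FiniteGaloisIntermediateField.le_iff _ _).mp (le_sup_left : FiniteGaloisIntermediateField.adjoin ℚ ({τ₀ θ} : Set cmNumbers) ≤ E)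
      (FiniteGaloisIntermediateField.subset_adjoin ℚ _ (Set.mem_singleton (τ₀ θ)))
  have hτ₀ : ∀ y : K, τ₀ y ∈ (E : IntermediateField ℚ cmNumbers) := fun y => by
    have hy : y ∈ ℚ⟮θ⟯ := by rw [hθ]; exact IntermediateField.mem_top
    have hy' : τ₀ y ∈ IntermediateField.map τ₀ ℚ⟮θ⟯ := ⟨y, hy, rfl⟩
    rw [IntermediateField.adjoin_map, Set.image_singleton] at hy'
    exact IntermediateField.adjoin_simple_le_iff.mpr hθE hy'
  let φ : K →ₐ[ℚ] (E : IntermediateField ℚ cmNumbers) :=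
    { toFun := fun y => ⟨τ₀ y, hτ₀ y⟩
      map_one' := Subtype.ext (map_one τ₀)
      map_mul' := fun a b => Subtype.ext (map_mul τ₀ a b)
      map_zero' := Subtype.ext (map_zero τ₀)
      map_add' := fun a b => Subtype.ext (map_add τ₀ a b)
      commutes' := fun q => Subtype.ext (τ₀.commutes q) }
  have hx' : Additive.toMul x ∈ weilLimitIn (E : IntermediateField ℚ cmNumbers) p (resLevel (E : IntermediateField ℚ cmNumbers) 1) :=
    weilLimitIn_le_of_algHom (p := p) φ τ₀ _ hx
  obtain ⟨g, hg⟩ := (mem_weilLimitIn_iff_exists_alphaCharOfPrime_eq p (𝔴.under (𝓞 (E : IntermediateField ℚ cmNumbers)))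
    (resLevel (E : IntermediateField ℚ cmNumbers) 1) _).mp hx'
  refine ⟨extendLevel (E : IntermediateField ℚ cmNumbers) g, ?_⟩
  rw [alphaLim_extendLevel]
  exact Additive.toMul.injective hg

/-- **LEVELWISE: `α(Λ^K) = W^K(p^∞)`** — on the level `X^*(S^K) = Λ^K ⊂ X^*(S)` the image of `α` is exactly g16-#3's `W^K(p^∞) = X^*(P^K)`
(LEMMA 5.1 at `K`: `X^*(α^K)` is onto, i.e. «`α^K : P^K → S^K` is injective»), for every finite Galois CM level `K`.
[cite: Milne1999, §5 p. 63 Lemma 5.1, Rem. 5.2 (a)] -/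
theorem image_alphaLim_lambdaLevel (K : FiniteGaloisIntermediateField ℚ cmNumbers) [IsCMField (K : IntermediateField ℚ cmNumbers)] :
    (fun F : infinityTypesCM => Additive.toMul (alphaLim p 𝔴 F)) ''
        {F | (F : (cmNumbers ≃ₐ[ℚ] cmNumbers) → ℤ) ∈ lambdaLevel (K : IntermediateField ℚ cmNumbers)} =
      (weilLimitIn (K : IntermediateField ℚ cmNumbers) p (resLevel (K : IntermediateField ℚ cmNumbers) 1) : Set (WeilLimit p)) := by
  ext x
  constructor
  · rintro ⟨F, hF, rfl⟩
    obtain ⟨g, rfl⟩ := exists_extendLevel_eq _ F hF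
    change Additive.toMul (alphaLim p 𝔴 (extendLevel (K : IntermediateField ℚ cmNumbers) g)) ∈ _
    rw [alphaLim_extendLevel]
    exact toMul_alphaCharOfPrime_mem_weilLimitIn p _ (resLevel (K : IntermediateField ℚ cmNumbers) 1) g
  · intro hx
    obtain ⟨g, hg⟩ := (mem_weilLimitIn_iff_exists_alphaCharOfPrime_eq p (𝔴.under (𝓞 (K : IntermediateField ℚ cmNumbers)))
      (resLevel (K : IntermediateField ℚ cmNumbers) 1) x).mp hx
    refine ⟨extendLevel (K : IntermediateField ℚ cmNumbers) g, extendLevel_mem_lambdaLevel _ g, ?_⟩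
    change Additive.toMul (alphaLim p 𝔴 (extendLevel (K : IntermediateField ℚ cmNumbers) g)) = x
    rw [alphaLim_extendLevel, hg]

/-- The same for the additive map. [cite: Milne1999, §5 p. 63 Rem. 5.2 (a)] -/
theorem alphaLimAddHom_surjective : Function.Surjective (alphaLimAddHom p 𝔴) := alphaLim_surjective p 𝔴

/-- **`W(p^∞) = ⋃_K α(Λ^K)` with `K` over the finite Galois CM levels** — g20-#1's exhaustion, now through the single map `α`.
[cite: Milne1999, §4 p. 61 L19–L21, §5 p. 63 Rem. 5.2 (a)] -/
theorem exists_level_alphaLim_eq (x : WeilLimit p) :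
    ∃ (K : FiniteGaloisIntermediateField ℚ cmNumbers) (_ : IsCMField (K : IntermediateField ℚ cmNumbers)) (F : infinityTypesCM),
      (F : (cmNumbers ≃ₐ[ℚ] cmNumbers) → ℤ) ∈ lambdaLevel (K : IntermediateField ℚ cmNumbers) ∧ alphaLim p 𝔴 F = Additive.ofMul x := by
  obtain ⟨F, hF⟩ := alphaLim_surjective p 𝔴 (Additive.ofMul x)
  exact ⟨cmLevel F, inferInstance, F, mem_lambdaLevel_cmLevel F, hF⟩

end Limit

/-! ### §5 On points: `α(R) : P(R) → S(R) = lim← S^K(R)` for every commutative `ℚ`-algebra `R` -/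

section Points

variable (p : ℕ) [hp : Fact p.Prime] (𝔴 : Ideal (𝓞 cmNumbers)) [h𝔴P : 𝔴.IsPrime] [h𝔴 : 𝔴.LiesOver (Ideal.span {(p : ℤ)})]
variable (R : Type u) [CommRing R] [Algebra ℚ R]

/-- **`α(R) : P(R) → S(R)`** («an injective homomorphism `α : P → S`», on `R`-points): `torusPoints.comap` of the equivariant `alphaLim`, from
g15-#3's `weilTorusPoints p R = P(R)` to g13-#4's `serreLimitPoints R = S(R)`. [cite: Milne1999, §5 p. 63 Rem. 5.2 (a)] -/
def alphaLimPoints : weilTorusPoints p R →* serreLimitPoints R :=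
  torusPoints.comap ℚ cmNumbers R infinityTypesCMRep (weilLimRep p) (alphaLim p 𝔴) (alphaLim_rep p 𝔴)

variable {R} in
/-- Values: `α(f)(F) = f(α F)`. [cite: Milne1999, §5 p. 63 Rem. 5.2 (a)] -/
theorem alphaLimPoints_apply_ofAdd (f : weilTorusPoints p R) (F : infinityTypesCM) :
    (alphaLimPoints p 𝔴 R f : Multiplicative infinityTypesCM →* (cmNumbers ⊗[ℚ] R)ˣ) (Multiplicative.ofAdd F) =
      (f : Multiplicative (Additive (WeilLimit p)) →* (cmNumbers ⊗[ℚ] R)ˣ) (Multiplicative.ofAdd (alphaLim p 𝔴 F)) := rfl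

variable {R} in
/-- **The values of `α(f)` on `X^*(S^K) ↪ X^*(S)` are those of `f` at `α^K`**: `α(f)(g^{ℚ^{cm}}) = f(α^K_{𝔴∩K}(g))`.
[cite: Milne1999, §5 p. 63 Rem. 5.2 (a)] -/
theorem alphaLimPoints_apply_extendLevel (K : FiniteGaloisIntermediateField ℚ cmNumbers) [IsCMField (K : IntermediateField ℚ cmNumbers)]
    (f : weilTorusPoints p R)
    (g : infinityTypes (cmNumbers ≃ₐ[ℚ] cmNumbers) ((K : IntermediateField ℚ cmNumbers) →ₐ[ℚ] cmNumbers) cmNumbersConj) :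
    (alphaLimPoints p 𝔴 R f : Multiplicative infinityTypesCM →* (cmNumbers ⊗[ℚ] R)ˣ)
        (Multiplicative.ofAdd (extendLevel (K : IntermediateField ℚ cmNumbers) g)) =
      (f : Multiplicative (Additive (WeilLimit p)) →* (cmNumbers ⊗[ℚ] R)ˣ)
        (Multiplicative.ofAdd (alphaCharOfPrime p (𝔴.under (𝓞 (K : IntermediateField ℚ cmNumbers))) g)) :=
  (alphaLimPoints_apply_ofAdd p 𝔴 f _).trans (by rw [alphaLim_extendLevel])

variable {R} in
/-- **The `K`-component of `α(f)` is `α^K(f)`**: on `X^*(S^K) ↪ X^*(S)` the point `α(f) ∈ S(R)` takes the values of g16-#2's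
`alphaPointsOfPrime p (𝔴 ∩ K) R f ∈ S^K(R)` — the family `(α^K(f))_K` of g20-#1/#2 IS `α(f)` read levelwise. [cite: Milne1999, §5 p. 63 Rem. 5.2 (a)] -/
theorem alphaLimPoints_apply_extendLevel_eq_alphaPointsOfPrime (K : FiniteGaloisIntermediateField ℚ cmNumbers)
    [IsCMField (K : IntermediateField ℚ cmNumbers)] (f : weilTorusPoints p R)
    (g : infinityTypes (cmNumbers ≃ₐ[ℚ] cmNumbers) ((K : IntermediateField ℚ cmNumbers) →ₐ[ℚ] cmNumbers) cmNumbersConj) :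
    (alphaLimPoints p 𝔴 R f : Multiplicative infinityTypesCM →* (cmNumbers ⊗[ℚ] R)ˣ)
        (Multiplicative.ofAdd (extendLevel (K : IntermediateField ℚ cmNumbers) g)) =
      (alphaPointsOfPrime p (𝔴.under (𝓞 (K : IntermediateField ℚ cmNumbers))) R f :
        Multiplicative (infinityTypes (cmNumbers ≃ₐ[ℚ] cmNumbers) ((K : IntermediateField ℚ cmNumbers) →ₐ[ℚ] cmNumbers) cmNumbersConj) →*
          (cmNumbers ⊗[ℚ] R)ˣ) (Multiplicative.ofAdd g) :=
  (alphaLimPoints_apply_extendLevel p 𝔴 K f g).trans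
    ((alphaPointsOfPrime_apply_ofAdd p (𝔴.under (𝓞 (K : IntermediateField ℚ cmNumbers))) f g).trans (germChar_apply _ f)).symm

/-- **`α(R) : P(R) → S(R)` IS INJECTIVE** for every commutative `ℚ`-algebra `R` («we obtain an injective homomorphism `α : P → S`»): `X^*(α)` is
onto (`alphaLim_surjective`), so a point of `P` is determined by its composite with it. [cite: Milne1999, §5 p. 63 Rem. 5.2 (a)] -/
theorem alphaLimPoints_injective : Function.Injective (alphaLimPoints p 𝔴 R) := fun f f' h => by
  refine Subtype.ext (MonoidHom.ext fun x => ?_)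
  obtain ⟨F, hF⟩ := alphaLim_surjective p 𝔴 (Multiplicative.toAdd x)
  have hx : x = Multiplicative.ofAdd (alphaLim p 𝔴 F) := by rw [hF, ofAdd_toAdd]
  have key := congrArg (fun s : serreLimitPoints R => (s : Multiplicative infinityTypesCM →* (cmNumbers ⊗[ℚ] R)ˣ) (Multiplicative.ofAdd F)) h
  rw [hx]
  exact (alphaLimPoints_apply_ofAdd p 𝔴 f F).symm.trans (key.trans (alphaLimPoints_apply_ofAdd p 𝔴 f' F))

end Points

/-! ### §6 The square `S(R) → S^K(R)`: `α(R)` followed by the projection to the level `K` is `α^K(R)` (with FILE 3's identification of carriers) -/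

section Square

variable (p : ℕ) [hp : Fact p.Prime] (𝔴 : Ideal (𝓞 cmNumbers)) [h𝔴P : 𝔴.IsPrime] [h𝔴 : 𝔴.LiesOver (Ideal.span {(p : ℤ)})]
variable (R : Type u) [CommRing R] [Algebra ℚ R]

/-- **`pr_K ∘ α(R) = α^K_{𝔴∩K}(R)` as maps `P(R) → S^K(R)`** for every finite Galois CM level `K` and every commutative `ℚ`-algebra `R`: g13-#4's
projection `toLevel : S(R) → S^K(R)` after `alphaLimPoints`, read in skel-3's carrier through FILE 3's `serreLevelPointsEquiv`, IS g16-#2's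
`alphaPointsOfPrime p (𝔴 ∩ K) R` — the point-level form of «on passing to the limit over all `K`». [cite: Milne1999, §5 p. 63 Rem. 5.2 (a)]
[cite: MilneCM2006, Ch. I §4 p. 42 («(S, μ_can) = lim← (S^K, μ^K)»)] -/
theorem serreLevelPointsEquiv_toLevel_alphaLimPoints (K : FiniteGaloisIntermediateField ℚ cmNumbers) [IsCMField (K : IntermediateField ℚ cmNumbers)]
    (f : weilTorusPoints p R) :
    serreLevelPointsEquiv R (K : IntermediateField ℚ cmNumbers) (toLevel R (K : IntermediateField ℚ cmNumbers) (alphaLimPoints p 𝔴 R f)) =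
      alphaPointsOfPrime p (𝔴.under (𝓞 (K : IntermediateField ℚ cmNumbers))) R f := by
  refine Subtype.ext (MonoidHom.ext fun x => ?_)
  exact (serreLevelPointsEquiv_toLevel_apply_ofAdd (alphaLimPoints p 𝔴 R f) (Multiplicative.toAdd x)).trans
    (alphaLimPoints_apply_extendLevel_eq_alphaPointsOfPrime p 𝔴 K f (Multiplicative.toAdd x))

end Square

end CMNumbers

end Literature.NumberTheory.ComplexMultiplication
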